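import Literature.AlgebraicGeometry.Motives.CartierDivisorClassPullback
import HarnessLib

/-!
# Restricting rational functions along a section: `s^♯ (μ^♯ J) = J`, units restrict to units

Topic `Literature/AlgebraicGeometry/Motives` (proofs only; no definitions, no named facts), `RatFn`
currency of `CartierDivisor.lean`. Let `μ : Y → X` be a dominant morphism of integral schemes with
a SECTION `s : X → Y` (`s ≫ μ = 𝟙`; e.g. `μ(x, y) = xy` on `E × E → E` and `s(x) = (x, ε)`). A
rational function `c ∈ K(Y)` regular at the point `s(η_X)` (`η_X` the generic point of `X`) has a
**restriction along `s`**: the element `s^♯_{η_X}(t) ∈ 𝒪_{X,η_X} = K(X)` of its germ `t` at `s(η_X)`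
(the germ is unique, `RatFn.toFunctionField_injective`). This file proves, without introducing a
definition:

* `stalkMap_eq_of_toFunctionField_eq_functionFieldMap` — **`s^♯ (μ^♯ J) = J`**: the restriction of
  `μ^♯ J` is `J` (`(s ≫ μ)^♯ = id` on stalks, Mathlib `Scheme.Hom.stalkMap_comp`,
  `stalkSpecializes_stalkMap`);
* `isUnitAt_stalkMap_of_isUnitAt` — **a rational function which is a unit at `s(p)` restricts to
  one which is a unit at `p`**, the restriction being computed at `η_X` (consistency of the germs
  along the specialisation `s(η_X) ⤳ s(p)`);
* `isUnitAt_inv_stalkMap_mul` — the combination used to normalise a rational top form by its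
  shear cocycle (Bosch–Lütkebohmert–Raynaud §4.2 Prop. 2, construction of the invariant form; cell
  `hodgecm-mathlib`, road W, leaf L4a' of W0-CORE-SPEC §3): if `c = v · μ^♯ J` with `v` a unit at
  `s(p)` and `J ≠ 0`, and `g := s^♯_{η}(germ of c)`, then `g⁻¹ · J` is a unit at `p`.

## Sources

* S. Bosch, W. Lütkebohmert, M. Raynaud, *Néron Models*, Springer 1990, §4.2 Prop. 2 (proof:
  pulling back along the unit section). [BLRNeronModels1990]
* U. Görtz, T. Wedhorn, *Algebraic Geometry I*, 2nd ed. 2020, Prop. 3.29 (rational functions and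
  local rings). [GortzWedhorn2020]
-/

noncomputable section

universe u

open CategoryTheory AlgebraicGeometry Opposite

namespace Literature.AlgebraicGeometry.Motives

namespace RatFn

variable {X Y : Scheme.{u}} [IsIntegral X] [IsIntegral Y] (s : X ⟶ Y) (μ : Y ⟶ X) [IsDominant μ]
  (hs : s ≫ μ = 𝟙 X)

omit [IsIntegral X] [IsIntegral Y] [IsDominant μ] in
include hs in
/-- The section maps every point of `X` to a point over it: `μ (s x) = x` (private helper). [folklore] -/
private theorem base_section_genericPoint_eq (x : X) : μ.base (s.base x) = x := by
  rw [← Scheme.Hom.comp_apply, hs]; rfl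

include hs in
/-- **`s^♯ (μ^♯ J) = J`**: if `t ∈ 𝒪_{Y, s(η_X)}` is the germ of the pulled-back rational function
`μ^♯ J`, `J ∈ K(X) = 𝒪_{X,η_X}`, then its image under `s^♯_{η_X}` is `J` (`(s ≫ μ)^♯_{η_X} = id`).
[cite: BLRNeronModels1990, §4.2 Prop. 2 (proof)] -/
theorem stalkMap_eq_of_toFunctionField_eq_functionFieldMap (J : X.functionField)
    (t : Y.presheaf.stalk (s.base (genericPoint X)))
    (ht : toFunctionField (s.base (genericPoint X)) t = functionFieldMap μ J) :
    s.stalkMap (genericPoint X) t = J := by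
  -- the explicit germ `t₀ := μ^♯_{s η} (J moved to the stalk at μ (s η) = η)`
  have hη : μ.base (s.base (genericPoint X)) ⤳ genericPoint X :=
    (base_section_genericPoint_eq s μ hs (genericPoint X)).symm ▸ specializes_rfl
  let t₀ : Y.presheaf.stalk (s.base (genericPoint X)) :=
    μ.stalkMap (s.base (genericPoint X)) (X.presheaf.stalkSpecializes hη J)
  have ht₀ : toFunctionField (s.base (genericPoint X)) t₀ = functionFieldMap μ J := by
    change (Y.presheaf.stalkSpecializes _) (μ.stalkMap _ (X.presheaf.stalkSpecializes hη J)) = _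
    rw [← Scheme.Hom.stalkSpecializes_stalkMap_apply μ (genericPoint Y) (s.base (genericPoint X))
      ((genericPoint_spec Y).specializes (Set.mem_univ _)),
      TopCat.Presheaf.stalkSpecializes_comp_apply]
    rfl
  have htt₀ : t = t₀ := toFunctionField_injective _ (ht.trans ht₀.symm)
  subst htt₀
  -- `s^♯ (μ^♯ (…)) = (s ≫ μ)^♯ (…) = id`
  have key : ∀ (f : X ⟶ X) (_ : f = 𝟙 X) (h : f.base (genericPoint X) ⤳ genericPoint X)
      (z : X.presheaf.stalk (genericPoint X)),
      f.stalkMap (genericPoint X) (X.presheaf.stalkSpecializes h z) = z := by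
    intro f hf h z
    subst hf
    have h1 : (𝟙 X : X ⟶ X).stalkMap (genericPoint X) = 𝟙 _ := Scheme.Hom.stalkMap_id X _
    have h2 : X.presheaf.stalkSpecializes h = 𝟙 _ := TopCat.Presheaf.stalkSpecializes_refl _ _
    rw [h2, h1]
    rfl
  change (μ.stalkMap (s.base (genericPoint X)) ≫ s.stalkMap (genericPoint X))
    (X.presheaf.stalkSpecializes hη J) = J
  rw [← Scheme.Hom.stalkMap_comp]
  exact key (s ≫ μ) hs hη J

/-- **Units at `s(p)` restrict to units at `p`.** Let `v ∈ K(Y)` be a unit at `s(p)` and let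
`t ∈ 𝒪_{Y, s(η_X)}` be its germ at `s(η_X)`; then the restriction `s^♯_{η_X}(t) ∈ K(X)` is a unit at
`p` (it is the rational function of the unit `s^♯_p(germ of v at s(p)) ∈ 𝒪_{X,p}ˣ`, by the
compatibility of stalk maps with specialisation). [cite: GortzWedhorn2020, Prop. 3.29 (1)] -/
theorem isUnitAt_stalkMap_of_isUnitAt {p : X} {v : Y.functionField} (hv : IsUnitAt (s.base p) v)
    (t : Y.presheaf.stalk (s.base (genericPoint X)))
    (ht : toFunctionField (s.base (genericPoint X)) t = v) :
    IsUnitAt p (s.stalkMap (genericPoint X) t) := by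
  obtain ⟨w, hw⟩ := hv
  have hsp : s.base (genericPoint X) ⤳ s.base p :=
    s.base.hom.map_specializes (genericPoint_specializes p)
  -- the germ at `s(η)` of `v` is the specialisation of the unit germ `w` at `s(p)`
  have htw : t = Y.presheaf.stalkSpecializes hsp (w : Y.presheaf.stalk (s.base p)) :=
    toFunctionField_injective _ (by rw [ht, toFunctionField_stalkSpecializes, hw])
  subst htw
  refine ⟨Units.map (s.stalkMap p).hom.toMonoidHom w, ?_⟩
  change toFunctionField p (s.stalkMap p w) = _
  change (X.presheaf.stalkSpecializes _) (s.stalkMap p w) = _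
  rw [← Scheme.Hom.stalkSpecializes_stalkMap_apply s (genericPoint X) p
    (genericPoint_specializes p)]

include hs in
/-- **Normalising by the shear cocycle** (BLR §4.2 Prop. 2, construction of the invariant volume form,
rational currency; W0-CORE-SPEC §3): if `c = v · μ^♯ J` in `K(Y)` with `v` a unit at `s(p)` and
`J ≠ 0`, and `g := s^♯_{η}(t)` for the germ `t` of `c` at `s(η_X)`, then `g = s^♯(v-germ) · J` and
`g⁻¹ · J` is a unit at `p`. [cite: BLRNeronModels1990, §4.2 Prop. 2 (proof)] -/
theorem isUnitAt_inv_stalkMap_mul {p : X} {c v : Y.functionField} {J : X.functionField}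
    (hc : c = v * functionFieldMap μ J) (hv : IsUnitAt (s.base p) v) (hJ : J ≠ 0)
    (t : Y.presheaf.stalk (s.base (genericPoint X)))
    (ht : toFunctionField (s.base (genericPoint X)) t = c) :
    IsUnitAt p ((s.stalkMap (genericPoint X) t)⁻¹ * J) := by
  -- germs of `v` and of `μ^♯ J` at `s η`
  have hvreg : IsRegularAt (s.base (genericPoint X)) v := by
    obtain ⟨w, hw⟩ := hv
    exact ⟨Y.presheaf.stalkSpecializes (s.base.hom.map_specializes (genericPoint_specializes p)) w,
      by rw [toFunctionField_stalkSpecializes, hw]⟩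
  obtain ⟨tv, htv⟩ := hvreg
  have hη : μ.base (s.base (genericPoint X)) ⤳ genericPoint X :=
    (base_section_genericPoint_eq s μ hs (genericPoint X)).symm ▸ specializes_rfl
  let tJ : Y.presheaf.stalk (s.base (genericPoint X)) :=
    μ.stalkMap (s.base (genericPoint X)) (X.presheaf.stalkSpecializes hη J)
  have htJ : toFunctionField (s.base (genericPoint X)) tJ = functionFieldMap μ J := by
    change (Y.presheaf.stalkSpecializes _) (μ.stalkMap _ (X.presheaf.stalkSpecializes hη J)) = _
    rw [← Scheme.Hom.stalkSpecializes_stalkMap_apply μ (genericPoint Y) (s.base (genericPoint X))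
      ((genericPoint_spec Y).specializes (Set.mem_univ _)),
      TopCat.Presheaf.stalkSpecializes_comp_apply]
    rfl
  have ht' : t = tv * tJ := toFunctionField_injective _ (by rw [map_mul, htv, htJ, ht, hc])
  have hg : s.stalkMap (genericPoint X) t = s.stalkMap (genericPoint X) tv * J := by
    rw [ht', map_mul, stalkMap_eq_of_toFunctionField_eq_functionFieldMap s μ hs J tJ htJ]
  have hunit : IsUnitAt p (s.stalkMap (genericPoint X) tv) :=
    isUnitAt_stalkMap_of_isUnitAt s hv tv htv
  rw [hg, mul_inv, mul_assoc, inv_mul_cancel₀ hJ, mul_one]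
  exact hunit.inv

end RatFn

end Literature.AlgebraicGeometry.Motives

end
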